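import Mathlib
import HarnessLib

/-!
# Parity floor `Σᵢ ‖Pᵢ^{odd} F‖² ≥ ‖F‖²` for globally odd `F` — stub `stub_oddParityFloor` of line `swap-odd-threshold-rigidity`
(crux `EmbeddedDrudeMourre.MourreDissolution`, item stmt-AtomisticToContinuum-12594; helper file, `--supports`)

Registered stub C-L of the checked skeleton of line `swap-odd-threshold-rigidity` (lead c7), in the
skeleton's stub namespace `Summit.AtomisticToContinuum.FouriersLaw.Theorems.MourreDissolution`.

For every measurable, globally odd `F : ℝ^{m+1} → ℝ` (`F (-k) = -F k`) and the coordinate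
reflections `Rᵢ k = update k i (-k i)`,
`∫_{cube} F² ≤ Σᵢ ∫_{cube} ((F − F∘Rᵢ)/2)²` on the cube `(−π,π]^{m+1}` (lower Lebesgue integrals of
`ENNReal.ofReal` of squares, so no integrability is needed).

Proof. We prove the general statement `oddParityFloor_pi` for the product `Measure.pi (fun _ => μ)`
of any σ-finite measure `μ` on `ℝ` that is invariant under `x ↦ -x`, for every number `n` of
coordinates (for `n = 0` a globally odd function vanishes), by induction on `n`, splitting off the
coordinate `0` with `MeasureTheory.measurePreserving_piFinSuccAbove` and Tonelli. The only analytic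
input is the "parallelogram lemma" `lintegral_sq_add_of_even_odd`: if `T` preserves the measure, `a`
is `T`-even and `b` is `T`-odd then `∫⁻ (a+b)² = ∫⁻ a² + ∫⁻ b²` (valid in `ℝ≥0∞`, no cross terms).
With `F = Fₑ + Fₒ` the even/odd parts in coordinate `0`: `∫⁻ F² = ∫⁻ Fₑ² + ∫⁻ Fₒ²`; for `i ≠ 0` the
reflections commute and `∫⁻ ((F−F∘Rᵢ)/2)² ≥ ∫⁻ ((Fₑ−Fₑ∘Rᵢ)/2)²`; the `i = 0` term is `∫⁻ Fₒ²`; and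
`Fₑ` is globally odd and `R₀`-even, so each slice `k' ↦ Fₑ (insertNth 0 y k')` is globally odd in
the remaining `n` coordinates, whence the induction hypothesis, integrated over `y`, gives
`∫⁻ Fₑ² ≤ Σ_{i ≠ 0} ∫⁻ ((Fₑ−Fₑ∘Rᵢ)/2)²`. The registered statement is the case
`μ = volume.restrict (Ioc (-π) π)` (`Measure.restrict_pi_pi`), which is reflection invariant because
`Ico (-π) π` and `Ioc (-π) π` differ by the null set `{±π}`.
-/

noncomputable section

namespace Summit.AtomisticToContinuum.FouriersLaw.Theorems.MourreDissolution

open MeasureTheory Filter Set Function Topology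
open scoped ENNReal

/-- Pointwise parallelogram identity in `ℝ≥0∞`:
`ofReal (a+b)² + ofReal (a−b)² = 2 (ofReal a² + ofReal b²)`. [folklore] -/
theorem ofReal_sq_add_add_ofReal_sq_sub (a b : ℝ) :
    ENNReal.ofReal ((a + b) ^ 2) + ENNReal.ofReal ((a - b) ^ 2) =
      2 * (ENNReal.ofReal (a ^ 2) + ENNReal.ofReal (b ^ 2)) := by
  rw [← ENNReal.ofReal_add (sq_nonneg _) (sq_nonneg _),
    ← ENNReal.ofReal_add (sq_nonneg _) (sq_nonneg _), ← ENNReal.ofReal_ofNat 2,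
    ← ENNReal.ofReal_mul (by norm_num)]
  congr 1
  ring

/-- **Parallelogram lemma (no cross terms in `ℝ≥0∞`).** If `T` preserves the measure `ν`, `a` is
`T`-even and `b` is `T`-odd (both measurable, real valued), then
`∫⁻ ofReal (a+b)² ∂ν = ∫⁻ ofReal a² ∂ν + ∫⁻ ofReal b² ∂ν`: indeed `∫⁻ (a+b)² = ∫⁻ (a+b)²∘T = ∫⁻ (a−b)²`,
so `2∫⁻ (a+b)² = ∫⁻ ((a+b)² + (a−b)²) = 2∫⁻ a² + 2∫⁻ b²`. [folklore] -/
theorem lintegral_sq_add_of_even_odd {X : Type*} [MeasurableSpace X] {ν : Measure X} {T : X → X}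
    (hT : MeasurePreserving T ν ν) {a b : X → ℝ} (ha : Measurable a) (hb : Measurable b)
    (hae : ∀ x, a (T x) = a x) (hbo : ∀ x, b (T x) = -b x) :
    ∫⁻ x, ENNReal.ofReal ((a x + b x) ^ 2) ∂ν =
      ∫⁻ x, ENNReal.ofReal (a x ^ 2) ∂ν + ∫⁻ x, ENNReal.ofReal (b x ^ 2) ∂ν := by
  have hmeas : ∀ c : X → ℝ, Measurable c → Measurable fun x => ENNReal.ofReal (c x ^ 2) :=
    fun c hc => (hc.pow_const 2).ennreal_ofReal
  have h1 : ∫⁻ x, ENNReal.ofReal ((a x - b x) ^ 2) ∂ν =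
      ∫⁻ x, ENNReal.ofReal ((a x + b x) ^ 2) ∂ν := by
    calc ∫⁻ x, ENNReal.ofReal ((a x - b x) ^ 2) ∂ν
        = ∫⁻ x, ENNReal.ofReal ((a (T x) + b (T x)) ^ 2) ∂ν := by
          simp only [hae, hbo, sub_eq_add_neg]
      _ = ∫⁻ x, ENNReal.ofReal ((a x + b x) ^ 2) ∂ν :=
          hT.lintegral_comp (f := fun x => ENNReal.ofReal ((a x + b x) ^ 2)) (hmeas _ (ha.add hb))
  have h2 : 2 * ∫⁻ x, ENNReal.ofReal ((a x + b x) ^ 2) ∂ν =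
      2 * (∫⁻ x, ENNReal.ofReal (a x ^ 2) ∂ν + ∫⁻ x, ENNReal.ofReal (b x ^ 2) ∂ν) := by
    calc 2 * ∫⁻ x, ENNReal.ofReal ((a x + b x) ^ 2) ∂ν
        = ∫⁻ x, ENNReal.ofReal ((a x + b x) ^ 2) ∂ν +
            ∫⁻ x, ENNReal.ofReal ((a x - b x) ^ 2) ∂ν := by rw [two_mul, h1]
      _ = ∫⁻ x, (ENNReal.ofReal ((a x + b x) ^ 2) + ENNReal.ofReal ((a x - b x) ^ 2)) ∂ν :=
          (lintegral_add_left (hmeas _ (ha.add hb)) _).symm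
      _ = ∫⁻ x, 2 * (ENNReal.ofReal (a x ^ 2) + ENNReal.ofReal (b x ^ 2)) ∂ν := by
          simp only [ofReal_sq_add_add_ofReal_sq_sub]
      _ = 2 * (∫⁻ x, ENNReal.ofReal (a x ^ 2) ∂ν + ∫⁻ x, ENNReal.ofReal (b x ^ 2) ∂ν) := by
          rw [lintegral_const_mul _ ((hmeas a ha).fun_add (hmeas b hb)),
            lintegral_add_left (hmeas a ha)]
  exact (ENNReal.mul_right_inj two_ne_zero ENNReal.ofNat_ne_top).1 h2

/-- Every coordinate reflection `k ↦ update k i (-k i)` preserves the product `Measure.pi (fun _ => μ)`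
of a σ-finite measure `μ` on `ℝ` that is invariant under `x ↦ -x`. [folklore] -/
theorem measurePreserving_update_neg {μ : Measure ℝ} [SigmaFinite μ]
    (hμ : MeasurePreserving (fun x : ℝ => -x) μ μ) {n : ℕ} (i : Fin n) :
    MeasurePreserving (fun k : Fin n → ℝ => Function.update k i (-k i))
      (Measure.pi fun _ : Fin n => μ) (Measure.pi fun _ : Fin n => μ) := by
  have hfun : (fun k : Fin n → ℝ => Function.update k i (-k i)) =
      fun k j => (if j = i then -k j else k j) := by
    funext k j
    rcases eq_or_ne j i with rfl | hj
    · simp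
    · simp [hj]
  rw [hfun]
  exact measurePreserving_pi (fun _ : Fin n => μ) (fun _ : Fin n => μ)
    (f := fun j x => if j = i then -x else x) fun j => by
      by_cases hj : j = i
      · subst hj; simpa using hμ
      · simp only [hj, if_false]
        exact ⟨measurable_id', Measure.map_id'⟩

/-- Tonelli along one coordinate of `Measure.pi (fun _ : Fin (n+1) => μ)`: splitting off the
coordinate `L` with `MeasurableEquiv.piFinSuccAbove`,
`∫⁻ G ∂(pi μ) = ∫⁻ y, ∫⁻ k', G (insertNth L y k') ∂(pi μ) ∂μ`. [folklore] -/
theorem lintegral_pi_insertNth {μ : Measure ℝ} [SigmaFinite μ] {n : ℕ} (L : Fin (n + 1))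
    {G : (Fin (n + 1) → ℝ) → ℝ≥0∞} (hG : Measurable G) :
    ∫⁻ k, G k ∂(Measure.pi fun _ : Fin (n + 1) => μ) =
      ∫⁻ y, ∫⁻ k', G (L.insertNth y k') ∂(Measure.pi fun _ : Fin n => μ) ∂μ := by
  have hmp := (measurePreserving_piFinSuccAbove (fun _ : Fin (n + 1) => μ) L).symm
  have hGe : Measurable fun p : ℝ × (Fin n → ℝ) =>
      G ((MeasurableEquiv.piFinSuccAbove (fun _ : Fin (n + 1) => ℝ) L).symm p) :=
    hG.comp (MeasurableEquiv.measurable _)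
  rw [← hmp.lintegral_comp hG, lintegral_prod _ hGe.aemeasurable]
  rfl

/-- Measurability of the inner integral of `lintegral_pi_insertNth` as a function of the frozen
coordinate. [folklore] -/
theorem measurable_lintegral_insertNth {μ : Measure ℝ} [SigmaFinite μ] {n : ℕ} (L : Fin (n + 1))
    {G : (Fin (n + 1) → ℝ) → ℝ≥0∞} (hG : Measurable G) :
    Measurable fun y : ℝ => ∫⁻ k', G (L.insertNth y k') ∂(Measure.pi fun _ : Fin n => μ) := by
  have hGe : Measurable fun p : ℝ × (Fin n → ℝ) =>
      G ((MeasurableEquiv.piFinSuccAbove (fun _ : Fin (n + 1) => ℝ) L).symm p) :=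
    hG.comp (MeasurableEquiv.measurable _)
  exact hGe.lintegral_prod_right'

/-- Inserting a frozen coordinate is measurable in the remaining coordinates. [folklore] -/
theorem measurable_insertNth_right {n : ℕ} (L : Fin (n + 1)) (y : ℝ) :
    Measurable fun k' : Fin n → ℝ => (L.insertNth y k' : Fin (n + 1) → ℝ) :=
  (MeasurableEquiv.piFinSuccAbove (fun _ : Fin (n + 1) => ℝ) L).symm.measurable.comp
    (measurable_const.prodMk measurable_id)

/-- **Parity floor, general form.** For a σ-finite measure `μ` on `ℝ` invariant under `x ↦ -x` and
every measurable globally odd `F` of `n` real variables,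
`∫⁻ F² ∂(pi μ) ≤ Σᵢ ∫⁻ ((F − F∘Rᵢ)/2)² ∂(pi μ)`, `Rᵢ k = update k i (-k i)` the reflection of the
`i`-th coordinate (in the parity-pattern decomposition only patterns with an odd, hence nonzero,
number of odd legs survive). Proved by induction on `n`, splitting off coordinate `0`. [folklore] -/
theorem oddParityFloor_pi {μ : Measure ℝ} [SigmaFinite μ]
    (hμ : MeasurePreserving (fun x : ℝ => -x) μ μ) :
    ∀ (n : ℕ) (F : (Fin n → ℝ) → ℝ), (∀ k, F (-k) = -F k) → Measurable F →
      ∫⁻ k, ENNReal.ofReal (F k ^ 2) ∂(Measure.pi fun _ : Fin n => μ) ≤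
        ∑ i : Fin n, ∫⁻ k, ENNReal.ofReal (((F k - F (Function.update k i (-k i))) / 2) ^ 2)
          ∂(Measure.pi fun _ : Fin n => μ) := by
  intro n
  induction n with
  | zero =>
    intro F hodd _
    have hF0 : ∀ k, F k = 0 := fun k => by
      have h := hodd k
      rw [show -k = k from Subsingleton.elim _ _] at h
      linarith
    simp [hF0]
  | succ n ih =>
    intro F hodd hF
    set P : Measure (Fin (n + 1) → ℝ) := Measure.pi fun _ : Fin (n + 1) => μ with hP
    set Q : Measure (Fin n → ℝ) := Measure.pi fun _ : Fin n => μ with hQ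
    -- the coordinate reflections preserve `P`
    have hR : ∀ i : Fin (n + 1),
        MeasurePreserving (fun k : Fin (n + 1) → ℝ => update k i (-k i)) P P :=
      fun i => measurePreserving_update_neg hμ i
    have hRm : ∀ i : Fin (n + 1), Measurable (fun k : Fin (n + 1) → ℝ => update k i (-k i)) :=
      fun i => (hR i).measurable
    -- pointwise bookkeeping of reflections: involutive, commuting, commuting with `-`
    have hRR : ∀ (i : Fin (n + 1)) (k : Fin (n + 1) → ℝ),
        update (update k i (-k i)) i (-(update k i (-k i)) i) = k := by
      intro i k
      ext j
      rcases eq_or_ne j i with rfl | h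
      · simp
      · simp [h]
    have hRcomm : ∀ (i j : Fin (n + 1)), i ≠ j → ∀ k : Fin (n + 1) → ℝ,
        update (update k j (-k j)) i (-(update k j (-k j)) i) =
          update (update k i (-k i)) j (-(update k i (-k i)) j) := by
      intro i j hij k
      ext l
      rcases eq_or_ne l i with rfl | hi
      · simp [hij]
      · rcases eq_or_ne l j with rfl | hj
        · simp [hi]
        · simp [hi, hj]
    have hRneg : ∀ (i : Fin (n + 1)) (k : Fin (n + 1) → ℝ),
        update (-k) i (-(-k) i) = -update k i (-k i) := by
      intro i k
      ext j
      rcases eq_or_ne j i with rfl | h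
      · simp
      · simp [h]
    -- even and odd parts of `F` in the coordinate `0`
    set Fe : (Fin (n + 1) → ℝ) → ℝ := fun k => (F k + F (update k 0 (-k 0))) / 2 with hFe
    set Fo : (Fin (n + 1) → ℝ) → ℝ := fun k => (F k - F (update k 0 (-k 0))) / 2 with hFo
    have hFe_m : Measurable Fe := (hF.add (hF.comp (hRm 0))).div_const 2
    have hFo_m : Measurable Fo := (hF.sub (hF.comp (hRm 0))).div_const 2
    have hFe_even : ∀ k, Fe (update k 0 (-k 0)) = Fe k := by
      intro k; simp only [hFe, hRR]; ring
    have hFo_odd : ∀ k, Fo (update k 0 (-k 0)) = -Fo k := by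
      intro k; simp only [hFo, hRR]; ring
    have hFe_odd : ∀ k, Fe (-k) = -Fe k := by
      intro k; simp only [hFe, hRneg, hodd]; ring
    have hsplit : ∀ k, F k = Fe k + Fo k := by
      intro k; simp only [hFe, hFo]; ring
    -- (1) `∫⁻ F² = ∫⁻ Fe² + ∫⁻ Fo²`
    have h1 : ∫⁻ k, ENNReal.ofReal (F k ^ 2) ∂P =
        ∫⁻ k, ENNReal.ofReal (Fe k ^ 2) ∂P + ∫⁻ k, ENNReal.ofReal (Fo k ^ 2) ∂P := by
      rw [← lintegral_sq_add_of_even_odd (hR 0) hFe_m hFo_m hFe_even hFo_odd]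
      simp only [← hsplit]
    -- (2) for `i = succAbove 0 j ≠ 0`: `∫⁻ ((Fe − Fe∘Rᵢ)/2)² ≤ ∫⁻ ((F − F∘Rᵢ)/2)²`
    have h2 : ∀ j : Fin n,
        ∫⁻ k, ENNReal.ofReal (((Fe k - Fe (update k (Fin.succAbove 0 j)
            (-k (Fin.succAbove 0 j)))) / 2) ^ 2) ∂P ≤
          ∫⁻ k, ENNReal.ofReal (((F k - F (update k (Fin.succAbove 0 j)
            (-k (Fin.succAbove 0 j)))) / 2) ^ 2) ∂P := by
      intro j
      have hi : Fin.succAbove 0 j ≠ 0 := Fin.succAbove_ne 0 j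
      set i : Fin (n + 1) := Fin.succAbove 0 j with hi_def
      set A : (Fin (n + 1) → ℝ) → ℝ := fun k => (Fe k - Fe (update k i (-k i))) / 2 with hA
      set B : (Fin (n + 1) → ℝ) → ℝ := fun k => (Fo k - Fo (update k i (-k i))) / 2 with hB
      have hA_m : Measurable A := (hFe_m.sub (hFe_m.comp (hRm i))).div_const 2
      have hB_m : Measurable B := (hFo_m.sub (hFo_m.comp (hRm i))).div_const 2
      have hA_even : ∀ k, A (update k 0 (-k 0)) = A k := by
        intro k
        simp only [hA, hRcomm i 0 hi, hFe_even]
      have hB_odd : ∀ k, B (update k 0 (-k 0)) = -B k := by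
        intro k
        simp only [hB, hRcomm i 0 hi, hFo_odd]
        ring
      have hAB : ∀ k, (F k - F (update k i (-k i))) / 2 = A k + B k := by
        intro k
        simp only [hA, hB, hsplit]
        ring
      calc ∫⁻ k, ENNReal.ofReal (A k ^ 2) ∂P
          ≤ ∫⁻ k, ENNReal.ofReal (A k ^ 2) ∂P + ∫⁻ k, ENNReal.ofReal (B k ^ 2) ∂P := le_self_add
        _ = ∫⁻ k, ENNReal.ofReal ((A k + B k) ^ 2) ∂P :=
          (lintegral_sq_add_of_even_odd (hR 0) hA_m hB_m hA_even hB_odd).symm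
        _ = ∫⁻ k, ENNReal.ofReal (((F k - F (update k i (-k i))) / 2) ^ 2) ∂P := by
          simp only [hAB]
    -- (4) slices of `Fe` are globally odd: induction hypothesis, integrated over the frozen leg
    have h4 : ∫⁻ k, ENNReal.ofReal (Fe k ^ 2) ∂P ≤
        ∑ j : Fin n, ∫⁻ k, ENNReal.ofReal (((Fe k - Fe (update k (Fin.succAbove 0 j)
            (-k (Fin.succAbove 0 j)))) / 2) ^ 2) ∂P := by
      have hG_m : ∀ j : Fin n, Measurable fun k : Fin (n + 1) → ℝ =>
          ENNReal.ofReal (((Fe k - Fe (update k (Fin.succAbove 0 j)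
            (-k (Fin.succAbove 0 j)))) / 2) ^ 2) :=
        fun j => (((hFe_m.sub (hFe_m.comp (hRm _))).div_const 2).pow_const 2).ennreal_ofReal
      have lhs_eq := lintegral_pi_insertNth (μ := μ) (0 : Fin (n + 1))
        ((hFe_m.pow_const 2).ennreal_ofReal)
      have rhs_eq : ∀ j : Fin n, ∫⁻ k, ENNReal.ofReal (((Fe k - Fe (update k (Fin.succAbove 0 j)
            (-k (Fin.succAbove 0 j)))) / 2) ^ 2) ∂P =
          ∫⁻ y, ∫⁻ k', ENNReal.ofReal (((Fe (Fin.insertNth 0 y k') -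
            Fe (update (Fin.insertNth 0 y k' : Fin (n + 1) → ℝ) (Fin.succAbove 0 j)
              (-(Fin.insertNth 0 y k' : Fin (n + 1) → ℝ) (Fin.succAbove 0 j)))) / 2) ^ 2) ∂Q ∂μ :=
        fun j => lintegral_pi_insertNth (μ := μ) 0 (hG_m j)
      rw [lhs_eq, Finset.sum_congr rfl (fun j _ => rhs_eq j),
        ← lintegral_finsetSum _ (fun j _ => measurable_lintegral_insertNth (μ := μ) 0 (hG_m j))]
      refine lintegral_mono fun y => ?_
      have hodd' : ∀ k' : Fin n → ℝ,
          Fe (Fin.insertNth 0 y (-k')) = -Fe (Fin.insertNth 0 y k') := by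
        intro k'
        have hins : (Fin.insertNth 0 y (-k') : Fin (n + 1) → ℝ) =
            update (-(Fin.insertNth 0 y k' : Fin (n + 1) → ℝ)) 0
              (-(-(Fin.insertNth 0 y k' : Fin (n + 1) → ℝ)) 0) := by
          simp [funext_iff, Fin.forall_iff_succAbove (0 : Fin (n + 1))]
        rw [hins, hFe_even, hFe_odd]
      have hm' : Measurable fun k' : Fin n → ℝ => Fe (Fin.insertNth 0 y k') :=
        hFe_m.comp (measurable_insertNth_right 0 y)
      have key := ih (fun k' => Fe (Fin.insertNth 0 y k')) hodd' hm'
      simp only [Fin.insertNth_apply_succAbove, ← Fin.insertNth_update] at key ⊢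
      exact key
    -- (5) combine: `∫⁻ F² = ∫⁻ Fe² + ∫⁻ Fo² ≤ Σ_{i ≠ 0} ∫⁻ ((F−F∘Rᵢ)/2)² + ∫⁻ ((F−F∘R₀)/2)²`
    calc ∫⁻ k, ENNReal.ofReal (F k ^ 2) ∂P
        = ∫⁻ k, ENNReal.ofReal (Fe k ^ 2) ∂P + ∫⁻ k, ENNReal.ofReal (Fo k ^ 2) ∂P := h1
      _ ≤ (∑ j : Fin n, ∫⁻ k, ENNReal.ofReal (((F k - F (update k (Fin.succAbove 0 j)
              (-k (Fin.succAbove 0 j)))) / 2) ^ 2) ∂P) +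
            ∫⁻ k, ENNReal.ofReal (((F k - F (update k 0 (-k 0))) / 2) ^ 2) ∂P :=
          add_le_add (h4.trans (Finset.sum_le_sum fun j _ => h2 j)) (le_of_eq (by simp only [hFo]))
      _ = ∑ i : Fin (n + 1), ∫⁻ k, ENNReal.ofReal (((F k - F (update k i (-k i))) / 2) ^ 2) ∂P := by
          rw [Fin.sum_univ_succAbove _ (0 : Fin (n + 1))]
          exact add_comm _ _

/-- The restriction of Lebesgue measure to the Brillouin cell `(−π, π]` is invariant under
`x ↦ -x` (the reflected cell `[−π, π)` differs from it by the null set `{±π}`). [folklore] -/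
theorem measurePreserving_neg_volume_restrict_Ioc :
    MeasurePreserving (fun x : ℝ => -x)
      ((volume : Measure ℝ).restrict (Set.Ioc (-Real.pi) Real.pi))
      ((volume : Measure ℝ).restrict (Set.Ioc (-Real.pi) Real.pi)) := by
  have h : MeasurePreserving (fun x : ℝ => -x) (volume : Measure ℝ) (volume : Measure ℝ) :=
    Measure.measurePreserving_neg (volume : Measure ℝ)
  have h2 := h.restrict_preimage (measurableSet_Ioc : MeasurableSet (Set.Ioc (-Real.pi) Real.pi))
  have hpre : (fun x : ℝ => -x) ⁻¹' Set.Ioc (-Real.pi) Real.pi = Set.Ico (-Real.pi) Real.pi := by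
    ext x
    simp only [Set.mem_preimage, Set.mem_Ioc, Set.mem_Ico]
    constructor
    · rintro ⟨h1, h2⟩; constructor <;> linarith
    · rintro ⟨h1, h2⟩; constructor <;> linarith
  rw [hpre, Measure.restrict_congr_set Ico_ae_eq_Ioc] at h2
  exact h2

/-- **Stub C-L of line `swap-odd-threshold-rigidity` (`stub_oddParityFloor`): the parity floor
`Σᵢ ‖Pᵢ^{odd}F‖² ≥ ‖F‖²` for globally odd `F`, uniformly in the number of legs.**
For every measurable `F : ℝ^{m+1} → ℝ` with `F (-k) = -F k`,
`∫_{(−π,π]^{m+1}} F² ≤ Σᵢ ∫_{(−π,π]^{m+1}} ((F − F∘Rᵢ)/2)²`, `Rᵢ k = update k i (-k i)` the reflection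
of the `i`-th coordinate (lower Lebesgue integrals; no integrability hypothesis). Specialisation of
`oddParityFloor_pi` to `μ = volume.restrict (Ioc (-π) π)` via `Measure.restrict_pi_pi` and
`measurePreserving_neg_volume_restrict_Ioc`. [folklore] -/
theorem stub_oddParityFloor :
    ∀ (m : ℕ) (F : (Fin (m + 1) → ℝ) → ℝ), (∀ k, F (-k) = -F k) → Measurable F →
      (∫⁻ k in Set.pi Set.univ (fun _ : Fin (m + 1) => Set.Ioc (-Real.pi) Real.pi),
          ENNReal.ofReal (F k ^ 2)) ≤
        ∑ i : Fin (m + 1),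
          ∫⁻ k in Set.pi Set.univ (fun _ : Fin (m + 1) => Set.Ioc (-Real.pi) Real.pi),
            ENNReal.ofReal (((F k - F (Function.update k i (-k i))) / 2) ^ 2) := by
  intro m F hodd hF
  have hcube : (volume : Measure (Fin (m + 1) → ℝ)).restrict
      (Set.pi Set.univ fun _ : Fin (m + 1) => Set.Ioc (-Real.pi) Real.pi) =
        Measure.pi fun _ : Fin (m + 1) => (volume : Measure ℝ).restrict (Set.Ioc (-Real.pi) Real.pi) := by
    rw [volume_pi]
    exact Measure.restrict_pi_pi _ _
  rw [hcube]
  exact oddParityFloor_pi measurePreserving_neg_volume_restrict_Ioc (m + 1) F hodd hF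

end Summit.AtomisticToContinuum.FouriersLaw.Theorems.MourreDissolution

end
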